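import Mathlib
import Literature.Computability.Complexity.ExtMonotoneGates
import Literature.Computability.Complexity.ExtMonotoneGRankSupport
import Literature.Computability.Complexity.CliqueApproximatorsWide
import Literature.Computability.Complexity.RossmanMonotoneCliqueProb
import Summits.PneNP.PneNP.Theses.ConvexRankGates
import Summits.PneNP.PneNP.Theorems.LinAlgGateBlind.Negative.DetGate
import Summits.PneNP.PneNP.Theorems.LinAlgGateBlind.Negative.CliquePolyDetRepr
import Summits.PneNP.PneNP.Theorems.LinAlgGateBlind.Negative.OnePermGate

/-!
# Skeleton line `dnf-invariant-wide-gates-see-small-cliques` for crux `LinAlgGateBlind` (stmt-PneNP-10681)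

Route `PneNP/ConvexRankGates`; crux decl `Summit.PneNP.PneNP.Theses.ConvexRankGates.LinAlgGateBlind`
(`∃ δ ∈ (0,1/2), ∀ c, ∀ᶠ m, no circuit with ≤ m^c gates over {∧₂,∨₂} ∪ PERM_{m^c} ∪ GRANK_{m^c} computes
CLIQUE(m, ⌈m^δ⌉₊)`); idea card `Cruxes/LinAlgGateBlind/Ideas/dnf-invariant-wide-gates-see-small-cliques.md`
(ideator 2; triage r1: pass ×3 with the MANDATORY sharpening "errors one-sided", honoured below).

THE LINE. Run the Alon–Boppana approximation method in the lattice `K(m, r, l)` of closed families of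
`≤ l`-vertex sets (tree: `Razborov.IsClosedFamily`, `Razborov.closure`) on the referee pair POSITIVES = bare
`k`-cliques `cliqueVec S` (`k = kOf m = ⌈m^{1/8}⌉₊`, counted), NEGATIVES = `G(m, q)` (`q = qOf m =
1 - 4 ln m / k`, the tree's product measure `prob q`), and push the invariant "every wire carries a
small-clique DNF `⌈F⌉ = ⋁_{X ∈ F} ⌈X⌉`" THROUGH each wide gate: a PERM/GRANK gate fed by small-clique DNFs
is literally ONE gate of the same class and the same size parameter over clique ATOMS `⌈X⌉`, `X ∈ 𝒱(l)` — a
TERM GATE (`IsTermGate`; `stub_termCollapse`: PERM∘OR ⊆ PERM by repeating generator wires, GRANK∘OR ⊆ GRANK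
at equal dimension since `Xᵢ ↦ Σ_a X'_{i,a}` preserves generic rank). Each term gate is replaced by the
closure of whatever small-clique DNF approximates it with ONE-SIDED errors `ε = epsOf c m = m^{-(c+1)}/4`
(lost `k`-cliques `lostPos`, gained `G(m,q)`-mass `gainedNeg`) — the single-gate statement `SGAt`, filed per
class as the two research stubs `stub_sgPerm`, `stub_sgGRank`. The ∧/∨ steps and the re-closure are the
classical lattice operations: `∧ ↦ A ∩ B` loses `≤ ((r-1)^l)² C(m-l-1, k-l-1)` cliques (tree, PROVED:
`card_errPos_le_wide`), `∨ ↦ (A ∪ B)*` and re-closure gain `≤ |𝒱(l)| (1 - q^{C(l,2)})^r` of `G(m,q)`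
(`stub_pluckingBound`, the `G(m,q)` twin of the tree's `card_errNeg_mul_le`). The host `stub_wideApproxHost`
is the generic straight-line induction over `{∧₂,∨₂} ∪ W` for ANY set `W` of monotone wide gates with a
per-gate interface `GateApprox`, plus the endgame (empty output family ⇒ every `k`-set lost; nonempty ⇒ it
accepts `≥ q^{C(l,2)}` of `G(m,q)`, which is `k`-clique-free up to `1/4`). `stub_denseRegime` is the
Alon–Boppana parameter calculus at `δ = 1/8` (`l = ⌊√(k/(4 log₂ m + 1))⌋`, `r = (l+c+2)(⌊log₂ m⌋+1)+2`):
`q^{C(l,2)} ≥ 1/2`, plucking and trimming budgets `≤ ε`, `m^c ε ≤ 1/16`, `Pr[G(m,q) ⊇ K_k] ≤ 1/4`.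
`LinAlgGateBlind_of` composes the six stubs into the crux BY NAME (`δ := 1/8`, `W := Lin (m^c)`, `t := m^c`,
`εP := ε`, `εN := 2ε`), a real proof; `LinAlgGateBlind_closed` feeds it the stubs.

DISPROOF USED (`Cruxes/LinAlgGateBlind/Disproof.lean` gen 2, all PROVED there; the three landed Negative
files are imported here and co-elaborate): read-back `linAlgGateBlind_iff` (re-proved below by `Iff.rfl`,
same `Lin`/`basis`); (a) `not_withoutSizeBound` — the size bound is used exactly once, as `t = m^c` in the
host's two union bounds `t·εP < 1`, `t·εN + Pr[clique] < q^{C(l,2)}`; `not_withoutBasis` — the host asks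
`GateApprox` only of gates of `W = Lin (m^c)` and monotonicity of every gate (a `¬` gate has no one-sided
approximator); `not_withoutPermDim` / `not_withoutGRankDim` / `not_blindDim_pow_kOf` /
`not_blindPermOnly_pow_kOf` — the SG stubs are asked only of term gates of parameter `≤ m^c`: at parameter
`m^{k+3}` ONE gate computes CLIQUE (`Negative.exists_onePermGate_computes_cliqueFn`,
`exists_oneGRankGate_computes_cliqueFn`) and for that term gate `O = CLIQUE` every small-clique DNF has
`lostPos = all` or `gainedNeg ≥ q^{C(l,2)} - Pr[clique] ≥ 1/4`, so SG is FALSE there — the stubs genuinely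
spend `d ≤ m^c`; `not_blindConstK` / `blind_window` — `δ = 1/8 > 0` fixed, `k → ∞` drives
`Pr[G(m,q) ⊇ K_k] → 0` in `stub_denseRegime`; `not_uniformThreshold` — every stub is `∀ c, ∀ᶠ m`.
(b) headline `dc_cliquePoly_superpolynomial_of_linAlgGateBlind`: inherited by `stub_sgGRank` ALONE (its
`O` ranges over affine symbolic pencils of dimension `m^c` with wild constants; a proof of it for the term
gates `CL_{m,k'}∘atoms` is a support-robust determinantal lower bound) — recorded as the hardest stub, the
PERM stub does not touch it. (d) `Sketch3Copy.not_shadowCliqueCover` concerns another card; no stub here has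
that shape. No stub is an instance of a landed Negative lemma (those are one-gate CONSTRUCTIONS at dimension
`2 + C(m,k)(#E - 1)` resp. `1 + C(m,k)#E`, far above `m^c`).

Conventions: `sorry` appears ONLY inside the six `stub_*` theorems; every other declaration is proved.
-/

set_option linter.unusedVariables false
set_option linter.unusedSectionVars false
set_option linter.dupNamespace false

namespace Summit.PneNP.PneNP.Cruxes.LinAlgGateBlind.DnfInvariantWideGatesSeeSmallCliques

open scoped BigOperators
open Finset Filter Literature.Computability.Complexity Razborov

noncomputable section

/-! ### §0 The crux read back with named pieces -/

/-- `Lin s = PERM_s ∪ GRANK_s`, the wide gates of the crux (the route's inline `let Lin`; texts of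
`IsPermGate`/`IsGRankGate` are literally those disjuncts). [folklore] -/
def Lin (s : ℕ) : Set GateFn := {g | IsPermGate s g ∨ IsGRankGate s g}

/-- The basis of the crux: `{∧₂, ∨₂} ∪ Lin s` (`= monotoneBasis ∪ Lin s` by `rfl`). [folklore] -/
def basis (s : ℕ) : Set GateFn := {GateFn.and 2, GateFn.or 2} ∪ Lin s

/-- The inner statement of the crux at exponent `δ` (clique size `⌈m^δ⌉₊`). [folklore] -/
def BlindAt (δ : ℝ) : Prop :=
  ∀ c : ℕ, ∀ᶠ m : ℕ in atTop, ∀ C : Circuit (KEdge m),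
    C.IsOver (basis (m ^ c)) → C.size ≤ m ^ c → ¬ C.Computes (cliqueFn m ⌈(m : ℝ) ^ δ⌉₊)

/-- **Read-back** (as in `Disproof.linAlgGateBlind_iff`): the crux IS `∃ δ ∈ (0,1/2), BlindAt δ`, by `Iff.rfl`
(the inline clique function is `cliqueFn`, the inline gate classes are `IsPermGate`/`IsGRankGate`). -/
theorem linAlgGateBlind_iff :
    Summit.PneNP.PneNP.Theses.ConvexRankGates.LinAlgGateBlind ↔
      ∃ δ : ℝ, 0 < δ ∧ δ < 1 / 2 ∧ BlindAt δ := Iff.rfl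

/-- `basis s = {∧₂, ∨₂} ∪ Lin s` with the tree's name for the monotone basis. -/
theorem basis_eq (s : ℕ) : basis s = monotoneBasis ∪ Lin s := rfl

/-- Every `Lin` gate computes a monotone Boolean function (tree: `IsPermGate.monotone`,
`IsGRankGate.monotone`). -/
theorem lin_monotone {s : ℕ} {g : GateFn} (hg : g ∈ Lin s) : Monotone g.2 := by
  rcases hg with hg | hg
  · exact hg.monotone
  · exact hg.monotone

/-! ### §1 Parameters of the line (`δ = 1/8`, the Alon–Boppana dense regime of the card) -/

/-- Clique size `k = ⌈m^{1/8}⌉₊` (`δ = 1/8`). [folklore] -/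
def kOf (m : ℕ) : ℕ := ⌈(m : ℝ) ^ (1 / 8 : ℝ)⌉₊

/-- Lattice parameter `l = ⌊√(k / (4 log₂ m + 1))⌋₊` (atoms have `≤ l` vertices; chosen so that an atom is
present in `G(m,q)` with probability `q^{C(l,2)} ≥ 1/2`). [folklore] -/
def lOf (m : ℕ) : ℕ := ⌊Real.sqrt ((kOf m : ℝ) / (4 * Real.logb 2 m + 1))⌋₊

/-- Sunflower parameter `r = (l + c + 2)(⌊log₂ m⌋ + 1) + 2` of `K(m, r, l)` (the card's petal number
`p ≈ (l + c + 2) log m`). [folklore] -/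
def rOf (c m : ℕ) : ℕ := (lOf m + c + 2) * (Nat.log 2 m + 1) + 2

/-- Edge density `q = 1 - 4 ln m / k` of the negative distribution `G(m, q)` (dense, `k`-clique-free with
high probability). [folklore] -/
def qOf (m : ℕ) : ℝ := 1 - 4 * Real.log m / (kOf m : ℝ)

/-- Per-gate error budget `ε = m^{-(c+1)} / 4`. [folklore] -/
def epsOf (c m : ℕ) : ℝ := (m : ℝ) ^ (-((c : ℝ) + 1)) / 4

/-- `0 ≤ ε`. -/
theorem epsOf_nonneg (c m : ℕ) : 0 ≤ epsOf c m :=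
  div_nonneg (Real.rpow_nonneg (Nat.cast_nonneg m) _) (by norm_num)

/-! ### §2 Small-clique DNFs, atoms, term gates and their one-sided errors on the referee pair -/

open Classical in
/-- The clique ATOM `⌈X⌉` as a Boolean function: all edges inside `X` are on (`CliquePresent`). [folklore] -/
def atomB {m : ℕ} (X : Finset (Fin m)) (x : KEdge m → Bool) : Bool := decide (CliquePresent X x)

open Classical in
/-- The small-clique DNF `⌈𝒜⌉ = ⋁_{X ∈ 𝒜} ⌈X⌉` as a Boolean function (`Accepts`). [folklore] -/
def acceptsB {m : ℕ} (𝒜 : Finset (Finset (Fin m))) (x : KEdge m → Bool) : Bool := decide (Accepts 𝒜 x)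

/-- **Term gates.** `IsTermGate m P l O`: the Boolean function `O` on graphs is ONE gate `g` with `P g`
(here `P = IsPermGate s` or `IsGRankGate s`) whose inputs are clique atoms `⌈X_a⌉` of small vertex sets
`X_a ∈ 𝒱(l)` (`smallSets`: `#X ≤ l`, `#X ≠ 1`; `X = ∅` is the constant-true atom). [folklore] -/
def IsTermGate (m : ℕ) (P : GateFn → Prop) (l : ℕ) (O : (KEdge m → Bool) → Bool) : Prop :=
  ∃ g : GateFn, P g ∧ ∃ X : Fin g.1 → Finset (Fin m),
    (∀ a, X a ∈ smallSets (Fin m) l) ∧ ∀ x, O x = g.2 (fun a => atomB (X a) x)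

open Classical in
/-- **Lost positives** (one-sided): the `k`-sets `S` whose bare clique `cliqueVec S` is accepted by `O` but
not by the small-clique DNF `⌈𝒜⌉` (the convention of the tree's `errPos`). [folklore] -/
def lostPos (m k : ℕ) (O : (KEdge m → Bool) → Bool) (𝒜 : Finset (Finset (Fin m))) :
    Finset (Finset (Fin m)) :=
  (powersetCard k (univ : Finset (Fin m))).filter fun S =>
    O (cliqueVec S) = true ∧ ¬ Accepts 𝒜 (cliqueVec S)

/-- **Gained negatives** (one-sided): `Pr_{G ∼ G(m,q)}[O(G) = 0 ∧ ⌈𝒜⌉(G) = 1]` (the convention of the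
tree's `errNeg`, with the product measure `prob q` in place of colourings). [folklore] -/
def gainedNeg (m : ℕ) (q : ℝ) (O : (KEdge m → Bool) → Bool) (𝒜 : Finset (Finset (Fin m))) : ℝ :=
  prob q (fun x : KEdge m → Bool => O x = false ∧ Accepts 𝒜 x)

/-- **SG, the single-gate statement of the card (ONE-SIDED, triage r1 mandatory sharpening).**
`SGAt m P l k q ε`: every term gate `O` with gate class `P` over `≤ l`-atoms is `ε`-approximated from the
clique side by SOME small-clique DNF `⌈𝒜⌉`, `𝒜 ⊆ 𝒱(l)`: at most `ε·C(m,k)` bare `k`-cliques are accepted by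
`O` but not by `⌈𝒜⌉`, and with probability at most `ε` a graph of `G(m,q)` is accepted by `⌈𝒜⌉` but rejected
by `O`. Trivial for `O` rejecting `≤ ε` of `G(m,q)` (`𝒜 = {∅}`) or accepting `≤ ε C(m,k)` bare cliques
(`𝒜 = ∅`); for the rest it says the accepted cliques are accepted LOCALLY (`sg_of_locality`). [folklore] -/
def SGAt (m : ℕ) (P : GateFn → Prop) (l k : ℕ) (q ε : ℝ) : Prop :=
  ∀ O : (KEdge m → Bool) → Bool, IsTermGate m P l O →
    ∃ 𝒜 ⊆ smallSets (Fin m) l,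
      (#(lostPos m k O 𝒜) : ℝ) ≤ ε * (m.choose k : ℝ) ∧ gainedNeg m q O 𝒜 ≤ ε

/-- **Per-gate interface of the host.** `GateApprox m k r l q εP εN g`: the gate `g`, fed with CLOSED
families `A_i ∈ K(m, r, l)` (i.e. with the small-clique DNFs `⌈A_i⌉` of its children), has a closed
approximator `F` losing `≤ εP·C(m,k)` bare `k`-cliques and gaining `≤ εN` of `G(m,q)`, one-sidedly. [folklore] -/
def GateApprox (m k r l : ℕ) (q εP εN : ℝ) (g : GateFn) : Prop :=
  ∀ A : Fin g.1 → Finset (Finset (Fin m)), (∀ i, IsClosedFamily r l (A i)) →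
    ∃ F : Finset (Finset (Fin m)), IsClosedFamily r l F ∧
      (#(lostPos m k (fun x => g.2 fun i => acceptsB (A i) x) F) : ℝ) ≤ εP * (m.choose k : ℝ) ∧
      gainedNeg m q (fun x => g.2 fun i => acceptsB (A i) x) F ≤ εN

/-! ### §3 Proved sanity lemmas: monotonicity, error monotonicity, locality ⇒ SG -/

open Classical in
/-- Atoms are monotone in the graph. -/
theorem atomB_mono {m : ℕ} (X : Finset (Fin m)) : Monotone (atomB X) := by
  intro x y hxy
  unfold atomB
  by_cases h : CliquePresent X x
  · have hy : CliquePresent X y := fun e he => eq_true_of_le_of_eq_true (hxy e) (h e he)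
    rw [decide_eq_true h, decide_eq_true hy]
  · rw [decide_eq_false h]
    exact Bool.false_le _

/-- A term gate over a class of monotone gates is a monotone function of the graph. -/
theorem isTermGate_monotone {m l : ℕ} {P : GateFn → Prop} (hP : ∀ g, P g → Monotone g.2)
    {O : (KEdge m → Bool) → Bool} (h : IsTermGate m P l O) : Monotone O := by
  obtain ⟨g, hg, X, -, hO⟩ := h
  intro x y hxy
  rw [hO x, hO y]
  exact hP g hg (fun a => atomB_mono (X a) hxy)

/-- Enlarging the approximating family can only shrink the set of lost positives. -/
theorem lostPos_anti {m k : ℕ} (O : (KEdge m → Bool) → Bool) {𝒜 ℬ : Finset (Finset (Fin m))}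
    (h : 𝒜 ⊆ ℬ) : lostPos m k O ℬ ⊆ lostPos m k O 𝒜 := by
  intro S hS
  simp only [lostPos, mem_filter] at hS ⊢
  exact ⟨hS.1, hS.2.1, fun hacc => hS.2.2 (hacc.mono h)⟩

/-- Replacing `𝒜` by a family `ℬ` gains at most the `G(m,q)`-mass of `[⌈ℬ⌉ ∧ ¬⌈𝒜⌉]` (union bound; used
with `ℬ = 𝒜*`, whose extra mass is the plucking error). -/
theorem gainedNeg_le_add {m : ℕ} {q : ℝ} (hq0 : 0 ≤ q) (hq1 : q ≤ 1) (O : (KEdge m → Bool) → Bool)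
    (𝒜 ℬ : Finset (Finset (Fin m))) :
    gainedNeg m q O ℬ ≤ gainedNeg m q O 𝒜 +
      prob q (fun x : KEdge m → Bool => Accepts ℬ x ∧ ¬ Accepts 𝒜 x) := by
  unfold gainedNeg
  calc prob q (fun x : KEdge m → Bool => O x = false ∧ Accepts ℬ x)
      ≤ prob q (fun x : KEdge m → Bool =>
          (O x = false ∧ Accepts 𝒜 x) ∨ (Accepts ℬ x ∧ ¬ Accepts 𝒜 x)) :=
        prob_mono hq0 hq1 fun x hx => by
          by_cases h𝒜 : Accepts 𝒜 x
          · exact Or.inl ⟨hx.1, h𝒜⟩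
          · exact Or.inr ⟨hx.2, h𝒜⟩
    _ ≤ _ := prob_or_le hq0 hq1 _ _

/-- In a graph containing the clique on `X`, the clique vector of `X` is below the graph. -/
theorem cliqueVec_le_of_cliquePresent {m : ℕ} {X : Finset (Fin m)} {x : KEdge m → Bool}
    (h : CliquePresent X x) : cliqueVec X ≤ x := by
  intro e
  rcases hX : cliqueVec X e with _ | _
  · exact Bool.false_le _
  · exact (h e ((cliqueVec_eq_true_iff X e).1 hX)).symm.le

open Classical in
/-- **Locality ⇒ SG (triage r1-1/r1-2 sharpening, PROVED).** For ANY monotone `O`: if all but `ε·C(m,k)` of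
the bare `k`-cliques accepted by `O` contain a small vertex set `X ∈ 𝒱(l)` whose bare clique `O` already
accepts, then `𝒜* = {X ∈ 𝒱(l) : O(K_X) = 1}` witnesses `SG(O)` with ZERO negative error (a graph containing
`K_X` with `O(K_X) = 1` is accepted by `O`, by monotonicity). So for term gates rejecting a non-negligible
part of `G(m,q)` the research stubs below are positive-side LOCALITY statements. -/
theorem sg_of_locality {m l k : ℕ} (q ε : ℝ) (O : (KEdge m → Bool) → Bool) (hO : Monotone O)
    (hloc : (#((powersetCard k (univ : Finset (Fin m))).filter fun S =>
        O (cliqueVec S) = true ∧ ∀ X ∈ smallSets (Fin m) l, X ⊆ S → O (cliqueVec X) = false) : ℝ)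
        ≤ ε * (m.choose k : ℝ)) :
    ∃ 𝒜 ⊆ smallSets (Fin m) l,
      (#(lostPos m k O 𝒜) : ℝ) ≤ ε * (m.choose k : ℝ) ∧ gainedNeg m q O 𝒜 = 0 := by
  refine ⟨(smallSets (Fin m) l).filter fun X => O (cliqueVec X) = true, filter_subset _ _, ?_, ?_⟩
  · have hsub : lostPos m k O ((smallSets (Fin m) l).filter fun X => O (cliqueVec X) = true) ⊆
        (powersetCard k (univ : Finset (Fin m))).filter fun S =>
          O (cliqueVec S) = true ∧ ∀ X ∈ smallSets (Fin m) l, X ⊆ S → O (cliqueVec X) = false := by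
      intro S hS
      simp only [lostPos, mem_filter] at hS
      obtain ⟨hSk, hOS, hnacc⟩ := hS
      refine mem_filter.2 ⟨hSk, hOS, fun X hX hXS => ?_⟩
      rcases hOX : O (cliqueVec X) with _ | _
      · rfl
      · exact absurd ⟨X, mem_filter.2 ⟨hX, hOX⟩, (cliquePresent_cliqueVec_self S).anti hXS⟩ hnacc
    exact le_trans (by exact_mod_cast card_le_card hsub) hloc
  · have hempty : prob q (fun x : KEdge m → Bool =>
        O x = false ∧ Accepts ((smallSets (Fin m) l).filter fun X => O (cliqueVec X) = true) x) =
        prob q (fun _ : KEdge m → Bool => False) := by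
      refine prob_congr fun x => ⟨?_, fun h => h.elim⟩
      rintro ⟨hOx, X, hX, hXx⟩
      have h1 : O (cliqueVec X) = true := (mem_filter.1 hX).2
      have h2 := hO (cliqueVec_le_of_cliquePresent hXx)
      rw [h1, hOx] at h2
      exact absurd h2 (by decide)
    unfold gainedNeg
    rw [hempty, prob_false]

/-! ### §4 The six stub STATEMENTS (named `Prop`s; the registered `stub_*` theorems restate them verbatim and
`Registered.stub_*` are the name-keyed aliases used as the hypotheses of `LinAlgGateBlind_of`) -/

/-- Statement of STUB 1 — TERM-GATE COLLAPSE (`Lin ∘ OR ⊆ Lin`, class by class, same size parameter): a PERM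
(resp. GRANK) gate of parameter `s` fed with the small-clique DNFs `⌈A_i⌉`, `A_i ⊆ 𝒱(l)`, is ONE PERM
(resp. GRANK) gate of parameter `s` over the atoms `⌈X⌉`, `X ∈ ⋃ A_i`. [folklore] -/
def TermCollapse : Prop :=
  ∀ (m s l : ℕ) (g : GateFn) (A : Fin g.1 → Finset (Finset (Fin m))),
    (∀ i, A i ⊆ smallSets (Fin m) l) →
      (IsPermGate s g → IsTermGate m (IsPermGate s) l fun x => g.2 fun i => acceptsB (A i) x) ∧
      (IsGRankGate s g → IsTermGate m (IsGRankGate s) l fun x => g.2 fun i => acceptsB (A i) x)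

/-- Statement of STUB 2 — PLUCKING UNDER `G(m,q)`: closing a family `𝒞 ⊆ 𝒱(l)` in `K(m, r, l)` wrongly
accepts a `q`-random graph with probability `≤ |𝒱(l)|·(1 - q^{C(l,2)})^r` (the `G(m,q)` twin of the tree's
`card_errNeg_mul_le` for colourings, Alon–Boppana 1987 Lemma 3.7). [folklore] -/
def PluckingBound : Prop :=
  ∀ (m r l : ℕ) (q : ℝ), 0 ≤ q → q ≤ 1 → ∀ 𝒞 : Finset (Finset (Fin m)), 𝒞 ⊆ smallSets (Fin m) l →
    prob q (fun x : KEdge m → Bool => Accepts (closure r l 𝒞) x ∧ ¬ Accepts 𝒞 x)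
      ≤ (#(smallSets (Fin m) l) : ℝ) * (1 - q ^ (l.choose 2)) ^ r

/-- Statement of STUB 3 — THE HOST (approximation method with wide gates, finite form): for a set `W` of
MONOTONE gate functions, if `∨` (closure of a union of closed families) gains `≤ εN`, `∧` (intersection)
loses `≤ εP·C(m,k)` `k`-cliques, and every `W`-gate over closed children has a closed one-sided
`(εP, εN)`-approximator (`GateApprox`), then no circuit over `{∧₂,∨₂} ∪ W` with `≤ t` gates computes
`CLIQUE(m,k)` as soon as `t·εP < 1` and `t·εN + Pr[G(m,q) ⊇ K_k] < q^{C(l,2)}`. [folklore] -/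
def WideApproxHost : Prop :=
  ∀ (m k r l t : ℕ) (q εP εN : ℝ) (W : Set GateFn),
    2 ≤ r → 2 ≤ l → k ≤ m → 0 ≤ q → q ≤ 1 → 0 ≤ εP → 0 ≤ εN →
    (∀ g ∈ W, Monotone g.2) →
    (∀ A B : Finset (Finset (Fin m)), IsClosedFamily r l A → IsClosedFamily r l B →
      prob q (fun x : KEdge m → Bool => Accepts (closure r l (A ∪ B)) x ∧ ¬ Accepts (A ∪ B) x) ≤ εN) →
    (∀ A B : Finset (Finset (Fin m)), IsClosedFamily r l A → IsClosedFamily r l B →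
      (#(errPos k A B) : ℝ) ≤ εP * (m.choose k : ℝ)) →
    (∀ g ∈ W, GateApprox m k r l q εP εN g) →
    (t : ℝ) * εP < 1 →
    (t : ℝ) * εN + prob q (fun x : KEdge m → Bool => cliqueFn m k x = true) < q ^ (l.choose 2) →
    ∀ C : Circuit (KEdge m), C.IsOver (monotoneBasis ∪ W) → C.size ≤ t →
      ¬ C.Computes (cliqueFn m k)

/-- Statement of STUB 4 — THE DENSE REGIME AT `δ = 1/8` (Alon–Boppana parameter calculus): eventually in
`m`, the lattice parameters are legal, `q ∈ [0,1]`, the plucking budget `|𝒱(l)|(1-q^{C(l,2)})^r` and the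
trimming budget `((r-1)^l)² C(m-l-1, k-l-1)` are `≤ ε` resp. `≤ ε C(m,k)`, `m^c ε ≤ 1/16`, `G(m,q)` has a
`k`-clique with probability `≤ 1/4`, and an atom is present with probability `q^{C(l,2)} ≥ 1/2`. [folklore] -/
def DenseRegime : Prop :=
  ∀ c : ℕ, ∀ᶠ m : ℕ in atTop,
    2 ≤ lOf m ∧ 2 ≤ rOf c m ∧ kOf m ≤ m ∧ 0 ≤ qOf m ∧ qOf m ≤ 1 ∧
    (#(smallSets (Fin m) (lOf m)) : ℝ) * (1 - qOf m ^ ((lOf m).choose 2)) ^ rOf c m ≤ epsOf c m ∧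
    ((((rOf c m - 1) ^ lOf m) ^ 2 * (m - (lOf m + 1)).choose (kOf m - (lOf m + 1)) : ℕ) : ℝ)
        ≤ epsOf c m * (m.choose (kOf m) : ℝ) ∧
    ((m ^ c : ℕ) : ℝ) * epsOf c m ≤ 1 / 16 ∧
    prob (qOf m) (fun x : KEdge m → Bool => cliqueFn m (kOf m) x = true) ≤ 1 / 4 ∧
    (1 / 2 : ℝ) ≤ qOf m ^ ((lOf m).choose 2)

/-- Statement of STUB 5 — SG FOR PERM TERM GATES (research): at `δ = 1/8`, for every `c`, eventually every
permutation-group-membership gate on `≤ m^c` points over `≤ lOf m`-atoms is one-sidedly `epsOf c m`-close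
on (bare `kOf m`-cliques) × `G(m, qOf m)` to some small-clique DNF. [folklore] -/
def SGPerm : Prop :=
  ∀ c : ℕ, ∀ᶠ m : ℕ in atTop, SGAt m (IsPermGate (m ^ c)) (lOf m) (kOf m) (qOf m) (epsOf c m)

/-- Statement of STUB 6 — SG FOR GRANK TERM GATES (research; Valiant-hard by the Disproof headline): the same
for generic-rank threshold gates of dimension `≤ m^c` over any field. [folklore] -/
def SGGRank : Prop :=
  ∀ c : ℕ, ∀ᶠ m : ℕ in atTop, SGAt m (IsGRankGate (m ^ c)) (lOf m) (kOf m) (qOf m) (epsOf c m)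

/-! ### §5 The six registered stubs (`sorry` lives ONLY in these six theorems) -/

/-- **Stub 1 — term-gate collapse `Lin ∘ OR ⊆ Lin` (provable now, M-sized).** PERM: index the new inputs by
the pairs `(i, X)`, `X ∈ A i` (via `Fintype.equivFin`), put `σ'_{(i,X)} := σ_i`, same `τ`, same `d`; the
selected generator SETS coincide: `{σ_i : ⌈A_i⌉(x)} = {σ'_{(i,X)} : ⌈X⌉(x)}`. GRANK: `K'_{(i,X)} := K_i`, same
`K₀, θ, d, F`; the killed symbolic matrix of the new gate is the image of the old one under the `F`-algebra
map `φ : X_i ↦ Σ_{X ∈ A_i, ⌈X⌉(x)} X'_{(i,X)}`, which kills exactly the unselected `X_i` and is injective on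
the polynomials in the selected ones (left inverse `X'_{(i,X₀(i))} ↦ X_i`, other `X' ↦ 0`), so a minor is
non-zero iff its image is (`le_rank_iff_exists_det_submatrix_ne_zero`, `det_submatrix_symbolicMatrix_eq_zero_iff`,
`killVars`): equal generic rank, SAME dimension `d` (triage r1: checked by all three triagers). -/
theorem stub_termCollapse :
    ∀ (m s l : ℕ) (g : GateFn) (A : Fin g.1 → Finset (Finset (Fin m))),
      (∀ i, A i ⊆ smallSets (Fin m) l) →
        (IsPermGate s g → IsTermGate m (IsPermGate s) l fun x => g.2 fun i => acceptsB (A i) x) ∧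
        (IsGRankGate s g → IsTermGate m (IsGRankGate s) l fun x => g.2 fun i => acceptsB (A i) x) := by
  sorry

/-- **Stub 2 — plucking under the product measure (provable now, M-sized).** Follow the tree's
`card_errNeg_mul_le` (induction on `|𝒱(l) ∖ 𝒞|`, adding one implied set `canon U` at a time, closure
unchanged by `closure_eq_of_subset_of_subset_closure`); the new error event is `⌈canon U⌉(x) ∧ ∀ i, ¬⌈W_i⌉(x)`
for implying members `W₁…W_r` (`Razborov.Implies`: `W_i ∩ W_j ⊆ U`), and the edge sets `E(K_{W_i}) ∖ E(K_U)`
are pairwise DISJOINT (an edge in two of them lies in `W_i ∩ W_j ⊆ U`), of size `≤ C(l,2)`; given `⌈U⌉`, each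
`W_i` misses an edge of its private set, independently under `prob q`: probability
`≤ ∏ (1 - q^{e_i}) ≤ (1 - q^{C(l,2)})^r` (`prob_forall_eq_true`, `BiasedMeasure`). Repeated `W_i = W_j ⊆ U`
gives an empty private set and probability `0`, still fine. -/
theorem stub_pluckingBound :
    ∀ (m r l : ℕ) (q : ℝ), 0 ≤ q → q ≤ 1 → ∀ 𝒞 : Finset (Finset (Fin m)), 𝒞 ⊆ smallSets (Fin m) l →
      prob q (fun x : KEdge m → Bool => Accepts (closure r l 𝒞) x ∧ ¬ Accepts 𝒞 x)
        ≤ (#(smallSets (Fin m) l) : ℝ) * (1 - q ^ (l.choose 2)) ^ r := by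
  sorry

/-- **Stub 3 — the host: Razborov/Alon–Boppana bookkeeping with wide gates + endgame (provable now,
M/L-sized).** Induction along `C.gates` exactly as the tree's `exists_rApprox_gates_wide` /
`ApproxScheme.exists_approx_gates`, with the invariant per wire `w ↦ F_w` closed: (P) every `k`-set `S`
outside a global lost set `BadP` with `w(K_S) = 1` has `⌈F_w⌉(K_S)`; (N) for every graph `x` off a global
gained EVENT `BadN`, `⌈F_w⌉(x) ⇒ w(x) = 1`. Inputs: `inputFamily l e` (exact, `RApprox.input`, needs
`r, l ≥ 2`); `∧₂ ↦ A ∩ B` (`BadP += errPos k A B`), `∨₂ ↦ (A ∪ B)*` (`BadN ∨= [⌈(A∪B)*⌉ ∧ ¬⌈A∪B⌉]`),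
a `W`-gate `g` with children families `A_a ↦` the `F` of `GateApprox` (`BadP += lostPos`, `BadN ∨= [O = 0 ∧ ⌈F⌉]`,
`O = g ∘ ⌈A_a⌉`), MONOTONICITY of `g` transporting the children's one-sided guarantees through `g`
(`exists_eq_andGate_of_fn_eq`, `wireOf_vals_append`, `getD_vals_append_cons` for the program plumbing).
Accounting: `#BadP ≤ size·εP·C(m,k)`, `Pr[BadN] ≤ size·εN` (`prob_or_le`). Endgame with `C.Computes
(cliqueFn m k)`: if `F_out = ∅` every `k`-set is lost (`cliqueFn_cliqueVec`, `k ≤ m` so `C(m,k) ≥ 1`),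
contradicting `t εP < 1`; else some `X ∈ F_out ⊆ 𝒱(l)` gives `Pr[⌈F_out⌉] ≥ Pr[⌈X⌉] = q^{#E(K_X)} ≥
q^{C(l,2)}` (`prob_forall_eq_true`, `q ≤ 1`), while (N) gives `Pr[⌈F_out⌉] ≤ Pr[BadN] + Pr[cliqueFn = 1]
≤ t εN + Pr[clique]` — contradiction with the last budget. Uses the size bound (Disproof `not_withoutSizeBound`)
and monotonicity of every gate (Disproof `not_withoutBasis`). -/
theorem stub_wideApproxHost :
    ∀ (m k r l t : ℕ) (q εP εN : ℝ) (W : Set GateFn),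
      2 ≤ r → 2 ≤ l → k ≤ m → 0 ≤ q → q ≤ 1 → 0 ≤ εP → 0 ≤ εN →
      (∀ g ∈ W, Monotone g.2) →
      (∀ A B : Finset (Finset (Fin m)), IsClosedFamily r l A → IsClosedFamily r l B →
        prob q (fun x : KEdge m → Bool => Accepts (closure r l (A ∪ B)) x ∧ ¬ Accepts (A ∪ B) x) ≤ εN) →
      (∀ A B : Finset (Finset (Fin m)), IsClosedFamily r l A → IsClosedFamily r l B →
        (#(errPos k A B) : ℝ) ≤ εP * (m.choose k : ℝ)) →
      (∀ g ∈ W, GateApprox m k r l q εP εN g) →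
      (t : ℝ) * εP < 1 →
      (t : ℝ) * εN + prob q (fun x : KEdge m → Bool => cliqueFn m k x = true) < q ^ (l.choose 2) →
      ∀ C : Circuit (KEdge m), C.IsOver (monotoneBasis ∪ W) → C.size ≤ t →
        ¬ C.Computes (cliqueFn m k) := by
  sorry

/-- **Stub 4 — the dense regime at `δ = 1/8` (provable now, M-sized real asymptotics; the card's cheapest
falsifier (a), re-derived by triage r1-2).** With `k = ⌈m^{1/8}⌉`, `l = ⌊√(k/(4 log₂ m+1))⌋`,
`r = (l+c+2)(⌊log₂ m⌋+1)+2`, `q = 1 - 4 ln m/k`, `ε = m^{-(c+1)}/4`: `l, r ≥ 2`, `k ≤ m`, `q ∈ [0,1]`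
(`k ≥ 4 ln m`) eventually; `q^{C(l,2)} ≥ 1 - C(l,2)·4 ln m/k ≥ 1 - 2 ln m/(4 log₂ m + 1) ≥ 1 - (ln 2)/2 > 1/2`
(Bernoulli, `C(l,2) ≤ l²/2 ≤ k/(2(4 log₂ m+1))`); plucking `|𝒱(l)| 2^{-r} ≤ (m+1)^l 2^{-(l+c+2) log₂ m - 2} ≤
m^{-(c+1)}/4` (`card_smallSets_le`); trimming `((r-1)^l)² C(m-l-1,k-l-1)/C(m,k) ≤ r^{2l} (k/m)^{l+1} =
m^{l/8 + o(l)} m^{-7(l+1)/8} 2^{l+1} ≤ m^{-(c+1)}/4` since `l → ∞`, `ln r = (1/16 + o(1)) ln m`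
(`choose_sub_le_choose_sub`-type ratios); `m^c ε = 1/(4m) ≤ 1/16`; first moment `Pr[G(m,q) ⊇ K_k] ≤
C(m,k) q^{C(k,2)} ≤ m^k e^{-2(k-1) ln m} = m^{2-k} ≤ 1/4` (`prob_exists_le`, `prob_forall_eq_true`,
`Real.add_pow_le_pow_mul_pow_of_sq_le_sq`/`Real.one_sub_le_exp_neg`-type bounds). Thresholds are huge
(`q ≥ 0` needs `m^{1/8} ≥ 4 ln m`) but only `∀ᶠ m` is claimed. -/
theorem stub_denseRegime :
    ∀ c : ℕ, ∀ᶠ m : ℕ in atTop,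
      2 ≤ lOf m ∧ 2 ≤ rOf c m ∧ kOf m ≤ m ∧ 0 ≤ qOf m ∧ qOf m ≤ 1 ∧
      (#(smallSets (Fin m) (lOf m)) : ℝ) * (1 - qOf m ^ ((lOf m).choose 2)) ^ rOf c m ≤ epsOf c m ∧
      ((((rOf c m - 1) ^ lOf m) ^ 2 * (m - (lOf m + 1)).choose (kOf m - (lOf m + 1)) : ℕ) : ℝ)
          ≤ epsOf c m * (m.choose (kOf m) : ℝ) ∧
      ((m ^ c : ℕ) : ℝ) * epsOf c m ≤ 1 / 16 ∧
      prob (qOf m) (fun x : KEdge m → Bool => cliqueFn m (kOf m) x = true) ≤ 1 / 4 ∧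
      (1 / 2 : ℝ) ≤ qOf m ^ ((lOf m).choose 2) := by
  sorry

/-- **Stub 5 — SG for PERM term gates (research; the PERM half of the crux in single-gate, one-sided,
distributional form).** For a permutation-group-membership gate `O(x) = [τ ∈ ⟨σ_a : ⌈X_a⌉(x)⟩]` on `≤ m^c`
points over atoms `X_a ∈ 𝒱(l)`: EITHER `O` rejects `≤ ε` of `G(m,q)` (take `𝒜 = {∅}`), OR all but
`ε C(m,k)` of the bare `k`-cliques `K_S` it accepts are accepted through a small sub-clique (`sg_of_locality`:
`𝒜* = {X ∈ 𝒱(l) : O(K_X) = 1}`, zero negative error), OR a genuinely mixed DNF exists. Abelian `σ_a` =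
monotone span programs over `ℤ/q'` whose rows are labelled by `≤ l`-cliques — Gál's rank-measure
characterisation and Pitassi–Robere lifting apply with atoms in place of variables and a free choice of
rectangle (accepted cliques × rejected graphs); nonabelian `σ_a` through the companion card
`invariant-module-linearisation` (ANDs of span tests double the atom size `l ↦ 2l`). Why it might be false:
a PERM gate of dimension `m^c` detecting mid-range cliques (`≥ 0.44k` vertices) on the pair would refute it —
for PERM that would be a distributional poly-size membership test for CLIQUE-like structure (no P/poly
contradiction, but none is known; the Disproof's one-gate CLIQUE needs `2 + C(m,k)(#E-1)` points,
`Negative.exists_onePermGate_computes_cliqueFn`). Counting cannot prove it beyond `d ≤ m^{2-δ}` (ideator BN2). -/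
theorem stub_sgPerm :
    ∀ c : ℕ, ∀ᶠ m : ℕ in atTop, SGAt m (IsPermGate (m ^ c)) (lOf m) (kOf m) (qOf m) (epsOf c m) := by
  sorry

/-- **Stub 6 — SG for GRANK term gates (research; the HARDEST stub, calibrated Valiant-hard).** For a
generic-rank threshold gate `O(x) = [θ ≤ rank (K₀ + Σ_{⌈X_a⌉(x)} X_a K_a)]`, `d ≤ m^c`, any field, over atoms
`X_a ∈ 𝒱(l)`: the same one-sided dichotomy. By `IsGRankGate.eq_true_iff_exists_support` the acceptance set is
the up-closure of the monomial supports of the `θ`-minors, so this says: a poly-dimension affine pencil whose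
minors' supports (read through atoms) touch `> ε` of the bare `k`-cliques only non-locally must have a
non-vanishing `θ`-minor on all but `ε` of `G(m,q)`. It contains the support-robust determinantal lower bound
of the Disproof headline (`dc_cliquePoly_superpolynomial_of_linAlgGateBlind`: term gates `CL_{m,k'} ∘ atoms`,
`k' ∈ (0.44k, k]`, wild constants) — `≥ VNP ⊄ VBP`-strength in every characteristic; algebraic natural
proofs / rank-method barriers (tree `RankMethodBarriers`, EGOW2018) bite on any rank-flattening proof. The
cancellation-free sub-case (generic entries on zero patterns = transversal-matroid / König gates) is the
reachable layer (cards `konig-atoms-cancellation-split` ≈ `theta-budget-flat-certificates`, counting range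
`d ≤ m^{2-δ}/polylog`); the planner-level repair pointer is re-typing GRANK to read-≤2 pencils (`IsReadK`). -/
theorem stub_sgGRank :
    ∀ c : ℕ, ∀ᶠ m : ℕ in atTop, SGAt m (IsGRankGate (m ^ c)) (lOf m) (kOf m) (qOf m) (epsOf c m) := by
  sorry

/-! ### §6 Name-keyed aliases of the six statements (the hypotheses of the composition) -/
namespace Registered

/-- Alias of `TermCollapse` keyed by the registered stub name. -/
abbrev stub_termCollapse : Prop := TermCollapse
/-- Alias of `PluckingBound` keyed by the registered stub name. -/
abbrev stub_pluckingBound : Prop := PluckingBound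
/-- Alias of `WideApproxHost` keyed by the registered stub name. -/
abbrev stub_wideApproxHost : Prop := WideApproxHost
/-- Alias of `DenseRegime` keyed by the registered stub name. -/
abbrev stub_denseRegime : Prop := DenseRegime
/-- Alias of `SGPerm` keyed by the registered stub name. -/
abbrev stub_sgPerm : Prop := SGPerm
/-- Alias of `SGGRank` keyed by the registered stub name. -/
abbrev stub_sgGRank : Prop := SGGRank

end Registered

/-! ### §7 The kernel-checked composition -/

/-- **Composition.** The six stubs imply the crux BY NAME. Take `δ = 1/8`; for each `c` intersect the
`∀ᶠ m` filters of the regime and of the two SG stubs; at such an `m` feed the host with `W := Lin (m^c)`,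
`t := m^c`, `εP := ε`, `εN := 2ε`: the `∨`-hypothesis is plucking (Stub 2) within budget, the `∧`-hypothesis is
the tree's `card_errPos_le_wide` within budget, and a `Lin` gate over closed children collapses (Stub 1) to a
term gate of its own class, gets an SG-approximator `𝒜` (Stub 5/6), and `𝒜*` is the closed approximator
(lost cliques can only decrease, `lostPos_anti`; gained mass grows by the plucking error, `gainedNeg_le_add` +
Stub 2); the two endgame budgets are `m^c ε ≤ 1/16` and `2/16 + 1/4 < 1/2 ≤ q^{C(l,2)}`. No `sorry`. -/
theorem LinAlgGateBlind_of (hColl : Registered.stub_termCollapse)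
    (hPluck : Registered.stub_pluckingBound) (hHost : Registered.stub_wideApproxHost)
    (hReg : Registered.stub_denseRegime) (hPerm : Registered.stub_sgPerm)
    (hGRank : Registered.stub_sgGRank) :
    Summit.PneNP.PneNP.Theses.ConvexRankGates.LinAlgGateBlind := by
  rw [linAlgGateBlind_iff]
  refine ⟨1 / 8, by norm_num, by norm_num, fun c => ?_⟩
  filter_upwards [hReg c, hPerm c, hGRank c] with m hR hP hG C hC hsize
  obtain ⟨hl, hr, hkm, hq0, hq1, hpl, hand, heps, hclq, hhalf⟩ := hR
  have hε : 0 ≤ epsOf c m := epsOf_nonneg c m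
  refine hHost m (kOf m) (rOf c m) (lOf m) (m ^ c) (qOf m) (epsOf c m) (2 * epsOf c m) (Lin (m ^ c))
    hr hl hkm hq0 hq1 hε (mul_nonneg (by norm_num) hε) (fun g hg => lin_monotone hg)
    ?_ ?_ ?_ ?_ ?_ C hC hsize
  · -- (∨): plucking within budget
    intro A B hA hB
    calc prob (qOf m) (fun x : KEdge m → Bool =>
          Accepts (closure (rOf c m) (lOf m) (A ∪ B)) x ∧ ¬ Accepts (A ∪ B) x)
        ≤ (#(smallSets (Fin m) (lOf m)) : ℝ) * (1 - qOf m ^ ((lOf m).choose 2)) ^ rOf c m :=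
          hPluck m (rOf c m) (lOf m) (qOf m) hq0 hq1 (A ∪ B) (union_subset hA.subset hB.subset)
      _ ≤ epsOf c m := hpl
      _ ≤ 2 * epsOf c m := by linarith
  · -- (∧): Alon–Boppana trimming count (tree) within budget
    intro A B hA hB
    calc (#(errPos (kOf m) A B) : ℝ)
        ≤ ((((rOf c m - 1) ^ lOf m) ^ 2 * (m - (lOf m + 1)).choose (kOf m - (lOf m + 1)) : ℕ) : ℝ) := by
          exact_mod_cast card_errPos_le_wide hr hA hB
      _ ≤ epsOf c m * (m.choose (kOf m) : ℝ) := hand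
  · -- wide gates: collapse to a term gate, SG, re-close
    intro g hg A hA
    have hsub : ∀ i, A i ⊆ smallSets (Fin m) (lOf m) := fun i => (hA i).subset
    obtain ⟨𝒜, h𝒜, hlost, hgain⟩ : ∃ 𝒜 ⊆ smallSets (Fin m) (lOf m),
        (#(lostPos m (kOf m) (fun x => g.2 fun i => acceptsB (A i) x) 𝒜) : ℝ)
            ≤ epsOf c m * (m.choose (kOf m) : ℝ) ∧
          gainedNeg m (qOf m) (fun x => g.2 fun i => acceptsB (A i) x) 𝒜 ≤ epsOf c m := by
      rcases hg with hg | hg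
      · exact hP _ ((hColl m (m ^ c) (lOf m) g A hsub).1 hg)
      · exact hG _ ((hColl m (m ^ c) (lOf m) g A hsub).2 hg)
    refine ⟨closure (rOf c m) (lOf m) 𝒜, isClosedFamily_closure _ _ _, ?_, ?_⟩
    · calc (#(lostPos m (kOf m) (fun x => g.2 fun i => acceptsB (A i) x)
            (closure (rOf c m) (lOf m) 𝒜)) : ℝ)
          ≤ (#(lostPos m (kOf m) (fun x => g.2 fun i => acceptsB (A i) x) 𝒜) : ℝ) := by
            exact_mod_cast card_le_card (lostPos_anti _ (subset_closure h𝒜))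
        _ ≤ epsOf c m * (m.choose (kOf m) : ℝ) := hlost
    · calc gainedNeg m (qOf m) (fun x => g.2 fun i => acceptsB (A i) x) (closure (rOf c m) (lOf m) 𝒜)
          ≤ gainedNeg m (qOf m) (fun x => g.2 fun i => acceptsB (A i) x) 𝒜 +
              prob (qOf m) (fun x : KEdge m → Bool =>
                Accepts (closure (rOf c m) (lOf m) 𝒜) x ∧ ¬ Accepts 𝒜 x) :=
            gainedNeg_le_add hq0 hq1 _ _ _
        _ ≤ epsOf c m + (#(smallSets (Fin m) (lOf m)) : ℝ) * (1 - qOf m ^ ((lOf m).choose 2)) ^ rOf c m :=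
            add_le_add hgain (hPluck m (rOf c m) (lOf m) (qOf m) hq0 hq1 𝒜 h𝒜)
        _ ≤ 2 * epsOf c m := by linarith
  · -- positive-side budget: `m^c ε ≤ 1/16 < 1`
    exact lt_of_le_of_lt heps (by norm_num)
  · -- negative-side budget: `2 m^c ε + Pr[clique] ≤ 1/8 + 1/4 < 1/2 ≤ q^{C(l,2)}`
    have h2 : ((m ^ c : ℕ) : ℝ) * (2 * epsOf c m) = 2 * (((m ^ c : ℕ) : ℝ) * epsOf c m) := by ring
    rw [h2]
    linarith

/-- **`LinAlgGateBlind_closed`** — the same composition as a CLOSED term (the crux modulo the six `stub_*`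
sorries): the registered stubs, stated verbatim, are definitionally the named statements and feed
`LinAlgGateBlind_of`. When all six stubs land, this theorem is the sorry-free proof to propose with
`--workitem stmt-PneNP-10681`. -/
theorem LinAlgGateBlind_closed : Summit.PneNP.PneNP.Theses.ConvexRankGates.LinAlgGateBlind :=
  LinAlgGateBlind_of stub_termCollapse stub_pluckingBound stub_wideApproxHost stub_denseRegime
    stub_sgPerm stub_sgGRank

end

end Summit.PneNP.PneNP.Cruxes.LinAlgGateBlind.DnfInvariantWideGatesSeeSmallCliques
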